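import Mathlib.Analysis.Normed.Group.InfiniteSum
import Literature.Analysis.FluidPDE.AlexakisDoeringInterpolation
import Literature.Analysis.FluidPDE.ScalarFourierDefs
import Literature.Analysis.FunctionSpaces.TorusFourierSeries
import HarnessLib

/-!
# Lattice toolkit for the Euler equations on `T³`, I: weighted `ℓ²` norms, Cauchy–Schwarz,
Young's inequality, interpolation

Analysis/FluidPDE support file, first of the files discharging the named fact
`Literature.Analysis.FluidPDE.Torus.eulerSmoothShortTime` (`EulerTorusLocalExistence.lean`:
short-time existence of smooth solutions of the Euler equations on `T³`; Majda–Bertozzi 2002,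
Thm. 3.4). The discharge is carried out on the Fourier side: a velocity field is the family of
its Fourier coefficients `c : ℤ^d → ℂ^d` (or a scalar sequence `ℤ^d → ℂ`), the Sobolev norms are
the weighted sums `‖c‖²_{h^s} = ∑_k (1 + |k|²)^s ‖c k‖²` (integer `s`, no square roots anywhere),
products become lattice convolutions (`ScalarFourier.lconv`) and the `H^m` energy estimate of
Majda–Bertozzi (Prop. 3.7) becomes an inequality between such sums (file
`EulerFourierEnergyEstimate`). This file supplies the elementary inequalities, all stated in
`ℝ≥0∞` so that no summability hypotheses are needed (finiteness propagates from right to left):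

* `sq_tsum_mul_le` — Cauchy–Schwarz `(∑' f g)² ≤ (∑' f²)(∑' g²)` for `ℝ≥0∞`-valued families,
  the squared form of the tree's `tsum_mul_le_sqrt_mul_sqrt` (`AlexakisDoeringInterpolation`,
  whence the import; its weighted companion `sq_tsum_mul_le_tsum_mul_tsum` is used as is);
* `hnorm s c = ∑_k (1+|k|²)^s ‖c k‖ₑ²`, `l1norm c = ∑_k ‖c k‖ₑ` and their algebra (monotonicity in
  `s`, scaling by symbols of polynomial growth); for `c = mFourierCoeff f` and integer `s`,
  `hnorm s c = Torus.eSobolevNorm s f ^ 2` (`TorusSobolevNorm`: `wt k ^ s = ofReal (sobolevWeight s k ^ 2)`),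
  so this is the tree's spectral Sobolev scale restricted to integer orders and read on sequences;
* **Young's inequality** `ℓ¹ ⋆ ℓ² ⊂ ℓ²` on `ℤ^d` in the two forms used by the energy estimate,
  `∑_k ‖(f ⋆ g)(k)‖² ≤ (∑ ‖f‖)² ∑ ‖g‖²` and `≤ ∑ ‖f‖² (∑ ‖g‖)²` (`hnorm_zero_lconv_le_left/right`);
* **interpolation** in the integer scale: log-convexity `‖c‖⁴_{h^s} ≤ ‖c‖²_{h^{s-1}} ‖c‖²_{h^{s+1}}`
  and its consequence `‖c‖²_{h^{s₁}} ‖c‖²_{h^{s₂}} ≤ ‖c‖²_{h^{r}} ‖c‖²_{h^{m}}` whenever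
  `r ≤ s₁, s₂` and `s₁ + s₂ ≤ r + m` (`hnorm_mul_hnorm_le`) — the exact (constant `1`) lattice
  analogue, between arbitrary integer orders, of the interpolation inequality Majda–Bertozzi use
  as Lemma 3.8 (`‖v‖_{s'} ≤ C_s ‖v‖₀^{1-s'/s} ‖v‖_s^{s'/s}`).

The embedding constant `∑_{ℤ³} ((1+|k|²)²)⁻¹ < ∞` and the vector-valued (transport-symbol)
inequalities are in part II (`EulerFourierTransport`).

## Mathlib / tree search

Mathlib: `enorm_tsum_le_tsum_enorm` (unconditional `‖∑' f‖ₑ ≤ ∑' ‖f‖ₑ`), `ENNReal.tsum_comm`,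
`ENNReal.tsum_mul_left`, `Equiv.tsum_eq`, `ENNReal.mul_le_mul_iff_left`; no discrete Young
inequality, no weighted sequence Sobolev scale (searched `young`, `lconv`, `convolution` in
`Topology/Algebra/InfiniteSum`; Mathlib's `DiscreteConvolution` has no `ℓ^p` bounds). Tree:
`tsum_mul_le_sqrt_mul_sqrt`, `sq_tsum_mul_le_tsum_mul_tsum` (`AlexakisDoeringInterpolation`, the
`ℝ≥0∞` Cauchy–Schwarz used here; ℤ-indexed twins in `DyadicSums`, `LittlewoodPaleyBilinear`), the sup-norm weighted lattice algebra of `ScalarFourierFamily` (`norm_lconv_le_mixed`,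
`HasDecay`), the lattice sums of `TorusFourierSeries`, the `ℓ²`-Sobolev functionals of functions
`Torus.eSobolevNorm` (`TorusSobolevNorm`, real exponents, functions on `T^d` rather than sequences).

## References

* A. J. Majda, A. L. Bertozzi, *Vorticity and Incompressible Flow*, CUP 2002, §3.2: Lemma 3.8
  (interpolation), (3.30) (Sobolev), Prop. 3.7. [`MajdaBertozziCUP2002`]
* L. Grafakos, *Classical Fourier Analysis*, 3rd ed. (2014), §3.1–3.3 (Fourier series on `T^d`,
  products as convolutions of coefficients). [`Grafakos2014`]
-/

open scoped ENNReal NNReal BigOperators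
open Filter

noncomputable section

namespace Literature.Analysis.FluidPDE

namespace EulerFourier

open ScalarFourier (lconv)
open Literature.Analysis.FunctionSpaces.Torus (freqNormSq freqNormSq_nonneg freqNormSq_neg)

/-! ### Cauchy–Schwarz for `ℝ≥0∞`-valued families, squared form -/

section ENN

variable {ι : Type*}

/-- **Cauchy–Schwarz for `ℝ≥0∞`-valued families**, squared: `(∑' f g)² ≤ (∑' f²) (∑' g²)`
(the square of the tree's `tsum_mul_le_sqrt_mul_sqrt`, `AlexakisDoeringInterpolation`). [folklore] -/
theorem sq_tsum_mul_le (f g : ι → ℝ≥0∞) :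
    (∑' i, f i * g i) ^ 2 ≤ (∑' i, f i ^ 2) * ∑' i, g i ^ 2 := by
  calc (∑' i, f i * g i) ^ 2
      ≤ ((∑' i, f i ^ 2) ^ (1 / 2 : ℝ) * (∑' i, g i ^ 2) ^ (1 / 2 : ℝ)) ^ 2 := by
        gcongr
        exact tsum_mul_le_sqrt_mul_sqrt f g
    _ = (∑' i, f i ^ 2) * ∑' i, g i ^ 2 := by
        rw [mul_pow, ENNReal.rpow_half_sq, ENNReal.rpow_half_sq]

end ENN

/-! ### Frequency weights in `ℝ≥0∞` and the weighted norms -/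

section Weights

variable {d : Type*} [Fintype d]

/-- The weight `1 + |k|²` of the frequency `k ∈ ℤ^d`, in `ℝ≥0∞` (the square of the Japanese
bracket; only integer powers of it are used, so that no square roots occur). [folklore] -/
def wt (k : d → ℤ) : ℝ≥0∞ := ENNReal.ofReal (1 + freqNormSq k)

/-- The squared length `|k|²` of the frequency `k`, in `ℝ≥0∞`. [folklore] -/
def fsq (k : d → ℤ) : ℝ≥0∞ := ENNReal.ofReal (freqNormSq k)

/-- Unfolding `wt`. [folklore] -/
theorem wt_def (k : d → ℤ) : wt k = ENNReal.ofReal (1 + freqNormSq k) := rfl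

/-- Unfolding `fsq`. [folklore] -/
theorem fsq_def (k : d → ℤ) : fsq k = ENNReal.ofReal (freqNormSq k) := rfl

/-- `1 + |k|² = 1 + |k|²` in `ℝ≥0∞`. [folklore] -/
theorem wt_eq_one_add_fsq (k : d → ℤ) : wt k = 1 + fsq k := by
  rw [wt, fsq, ENNReal.ofReal_add zero_le_one (freqNormSq_nonneg k), ENNReal.ofReal_one]

/-- `1 ≤ 1 + |k|²`. [folklore] -/
theorem one_le_wt (k : d → ℤ) : 1 ≤ wt k := by
  rw [wt_eq_one_add_fsq]; exact le_self_add

/-- `|k|² ≤ 1 + |k|²`. [folklore] -/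
theorem fsq_le_wt (k : d → ℤ) : fsq k ≤ wt k := by
  rw [wt_eq_one_add_fsq]; exact le_add_self

/-- The weight is finite. [folklore] -/
theorem wt_ne_top (k : d → ℤ) : wt k ≠ ∞ := ENNReal.ofReal_ne_top

/-- The weight is nonzero. [folklore] -/
theorem wt_ne_zero (k : d → ℤ) : wt k ≠ 0 := (lt_of_lt_of_le one_pos (one_le_wt k)).ne'

/-- `|k|²` is finite. [folklore] -/
theorem fsq_ne_top (k : d → ℤ) : fsq k ≠ ∞ := ENNReal.ofReal_ne_top

/-- The weight is even: `1 + |-k|² = 1 + |k|²`. [folklore] -/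
@[simp] theorem wt_neg (k : d → ℤ) : wt (-k) = wt k := by rw [wt, wt, freqNormSq_neg]

/-- `|-k|² = |k|²`. [folklore] -/
@[simp] theorem fsq_neg (k : d → ℤ) : fsq (-k) = fsq k := by rw [fsq, fsq, freqNormSq_neg]

/-- Powers of the weight are monotone in the exponent (`1 + |k|² ≥ 1`). [folklore] -/
theorem wt_pow_mono (k : d → ℤ) {s s' : ℕ} (h : s ≤ s') : wt k ^ s ≤ wt k ^ s' :=
  pow_le_pow_right₀ (one_le_wt k) h

/-- `|k|²^a (1+|k|²)^s ≤ (1+|k|²)^(s+a)`. [folklore] -/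
theorem fsq_pow_mul_wt_pow_le (k : d → ℤ) (a s : ℕ) : fsq k ^ a * wt k ^ s ≤ wt k ^ (s + a) := by
  rw [pow_add, mul_comm]
  gcongr
  exact fsq_le_wt k

/-- A single coordinate is bounded by the length: `kⱼ² ≤ |k|²` in `ℝ≥0∞`. [folklore] -/
theorem ofReal_sq_apply_le_fsq (k : d → ℤ) (j : d) : ENNReal.ofReal ((k j : ℝ) ^ 2) ≤ fsq k := by
  refine ENNReal.ofReal_le_ofReal ?_
  exact Finset.single_le_sum (f := fun i => ((k i : ℝ)) ^ 2) (fun i _ => sq_nonneg _)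
    (Finset.mem_univ j)

variable {E : Type*} [NormedAddCommGroup E]

/-- The **weighted `ℓ²` (Sobolev `h^s`) functional** of a sequence `c : ℤ^d → E`,
`hnorm s c = ∑_k (1 + |k|²)^s ‖c k‖²  ∈ [0, ∞]` — the square of the `H^s(T^d)` norm of the field
with Fourier coefficients `c` (Majda–Bertozzi 2002, (3.5) with the Fourier characterisation of
`H^s`; Grafakos 2014, §3.3). [folklore] -/
def hnorm (s : ℕ) (c : (d → ℤ) → E) : ℝ≥0∞ := ∑' k, wt k ^ s * ‖c k‖ₑ ^ 2

/-- The **`ℓ¹` functional** `l1norm c = ∑_k ‖c k‖ ∈ [0, ∞]` (the Wiener-algebra norm, which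
dominates the sup norm of the synthesised field). [folklore] -/
def l1norm (c : (d → ℤ) → E) : ℝ≥0∞ := ∑' k, ‖c k‖ₑ

/-- Unfolding `hnorm`. [folklore] -/
theorem hnorm_def (s : ℕ) (c : (d → ℤ) → E) : hnorm s c = ∑' k, wt k ^ s * ‖c k‖ₑ ^ 2 := rfl

omit [Fintype d] in
/-- Unfolding `l1norm`. [folklore] -/
theorem l1norm_def (c : (d → ℤ) → E) : l1norm c = ∑' k, ‖c k‖ₑ := rfl

/-- `hnorm 0 c = ∑_k ‖c k‖²`. [folklore] -/
theorem hnorm_zero (c : (d → ℤ) → E) : hnorm 0 c = ∑' k, ‖c k‖ₑ ^ 2 := by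
  simp [hnorm]

/-- The scale is monotone: `‖c‖_{h^s} ≤ ‖c‖_{h^{s'}}` for `s ≤ s'`. [folklore] -/
theorem hnorm_mono {s s' : ℕ} (h : s ≤ s') (c : (d → ℤ) → E) : hnorm s c ≤ hnorm s' c :=
  ENNReal.tsum_le_tsum fun k => mul_le_mul' (wt_pow_mono k h) le_rfl

/-- A single term is bounded by the functional: `(1+|k|²)^s ‖c k‖² ≤ hnorm s c`. [folklore] -/
theorem term_le_hnorm (s : ℕ) (c : (d → ℤ) → E) (k : d → ℤ) :
    wt k ^ s * ‖c k‖ₑ ^ 2 ≤ hnorm s c :=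
  ENNReal.le_tsum (f := fun k => wt k ^ s * ‖c k‖ₑ ^ 2) k

omit [Fintype d] in
/-- A single term is bounded by the `ℓ¹` functional. [folklore] -/
theorem enorm_le_l1norm (c : (d → ℤ) → E) (k : d → ℤ) : ‖c k‖ₑ ≤ l1norm c :=
  ENNReal.le_tsum (f := fun k => ‖c k‖ₑ) k

/-- `hnorm` of the zero sequence vanishes. [folklore] -/
@[simp] theorem hnorm_zero_fun (s : ℕ) : hnorm s (fun _ : d → ℤ => (0 : E)) = 0 := by
  simp [hnorm]

/-- `hnorm` of the zero sequence vanishes (`Pi.zero` form). [folklore] -/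
@[simp] theorem hnorm_zero_fun' (s : ℕ) : hnorm s (0 : (d → ℤ) → E) = 0 :=
  hnorm_zero_fun s

omit [Fintype d] in
/-- `l1norm` of the zero sequence vanishes. [folklore] -/
@[simp] theorem l1norm_zero_fun : l1norm (fun _ : d → ℤ => (0 : E)) = 0 := by
  simp [l1norm]

/-- If `hnorm s c = 0` then `c = 0` (every weight is nonzero). [folklore] -/
theorem eq_zero_of_hnorm_eq_zero {s : ℕ} {c : (d → ℤ) → E} (h : hnorm s c = 0) : c = 0 := by
  funext k
  have hk : wt k ^ s * ‖c k‖ₑ ^ 2 = 0 := le_antisymm ((term_le_hnorm s c k).trans_eq h) bot_le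
  rcases mul_eq_zero.1 hk with h1 | h1
  · exact absurd h1 (pow_ne_zero _ (wt_ne_zero k))
  · simpa using h1

/-- **Symbols of polynomial growth shift the scale**: if `‖σ k • c k‖ₑ² ≤ |k|²^a ‖c k‖²`-type
bounds hold termwise, precisely `‖c' k‖ₑ ^ 2 ≤ fsq k ^ a * ‖c k‖ₑ ^ 2` for all `k`, then
`hnorm s c' ≤ hnorm (s + a) c` (the lattice form of `‖∂^a u‖_{H^s} ≤ ‖u‖_{H^{s+a}}`). [folklore] -/
theorem hnorm_le_hnorm_add_of_le {E' : Type*} [NormedAddCommGroup E'] {c' : (d → ℤ) → E'}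
    {c : (d → ℤ) → E} {a : ℕ} (h : ∀ k, ‖c' k‖ₑ ^ 2 ≤ fsq k ^ a * ‖c k‖ₑ ^ 2) (s : ℕ) :
    hnorm s c' ≤ hnorm (s + a) c := by
  refine ENNReal.tsum_le_tsum fun k => ?_
  calc wt k ^ s * ‖c' k‖ₑ ^ 2 ≤ wt k ^ s * (fsq k ^ a * ‖c k‖ₑ ^ 2) := by gcongr; exact h k
    _ = (fsq k ^ a * wt k ^ s) * ‖c k‖ₑ ^ 2 := by ring
    _ ≤ wt k ^ (s + a) * ‖c k‖ₑ ^ 2 := by gcongr; exact fsq_pow_mul_wt_pow_le k a s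

/-- Termwise domination is inherited by every `hnorm`. [folklore] -/
theorem hnorm_le_hnorm_of_le {E' : Type*} [NormedAddCommGroup E'] {c' : (d → ℤ) → E'}
    {c : (d → ℤ) → E} (h : ∀ k, ‖c' k‖ₑ ≤ ‖c k‖ₑ) (s : ℕ) : hnorm s c' ≤ hnorm s c :=
  ENNReal.tsum_le_tsum fun k => by gcongr; exact h k

omit [Fintype d] in
/-- Termwise domination is inherited by `l1norm`. [folklore] -/
theorem l1norm_le_l1norm_of_le {E' : Type*} [NormedAddCommGroup E'] {c' : (d → ℤ) → E'}
    {c : (d → ℤ) → E} (h : ∀ k, ‖c' k‖ₑ ≤ ‖c k‖ₑ) : l1norm c' ≤ l1norm c :=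
  ENNReal.tsum_le_tsum h

/-- **Log-convexity of the integer scale**: `‖c‖⁴_{h^{s+1}} ≤ ‖c‖²_{h^s} ‖c‖²_{h^{s+2}}` (weighted
Cauchy–Schwarz with weights `(1+|k|²)^s ‖c k‖²`); the exact lattice analogue of the interpolation
inequality Majda–Bertozzi 2002 quote as Lemma 3.8. [folklore] -/
theorem hnorm_succ_sq_le (s : ℕ) (c : (d → ℤ) → E) :
    hnorm (s + 1) c ^ 2 ≤ hnorm s c * hnorm (s + 2) c := by
  have h := sq_tsum_mul_le_tsum_mul_tsum (fun k => wt k) (fun k => wt k ^ s * ‖c k‖ₑ ^ 2)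
  have h1 : ∀ k, wt k * (wt k ^ s * ‖c k‖ₑ ^ 2) = wt k ^ (s + 1) * ‖c k‖ₑ ^ 2 := fun k => by ring
  have h2 : ∀ k, wt k ^ 2 * (wt k ^ s * ‖c k‖ₑ ^ 2) = wt k ^ (s + 2) * ‖c k‖ₑ ^ 2 := fun k => by
    ring
  simp only [h1, h2] at h
  exact h

end Weights

/-! ### Young's inequality `ℓ¹ ⋆ ℓ² ⊂ ℓ²` on the lattice -/

section Young

variable {d : Type*} [Fintype d]

omit [Fintype d] in
/-- **The lattice convolution is commutative**: `∑ₘ f(m) g(k-m) = ∑ₘ g(m) f(k-m)`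
(reindex `m ↦ k - m`). [folklore] -/
theorem lconv_comm (f g : (d → ℤ) → ℂ) (k : d → ℤ) : lconv f g k = lconv g f k := by
  rw [lconv, lconv]
  calc ∑' m, f m * g (k - m) = ∑' m, (fun n => g n * f (k - n)) ((Equiv.subLeft k) m) := by
        refine tsum_congr fun m => ?_
        simp only [Equiv.subLeft_apply, sub_sub_cancel, mul_comm]
    _ = ∑' n, g n * f (k - n) := (Equiv.subLeft k).tsum_eq (fun n => g n * f (k - n))

omit [Fintype d] in
/-- `‖(f ⋆ g)(k)‖ ≤ ∑ₘ ‖f m‖ ‖g (k - m)‖` in `ℝ≥0∞`, unconditionally. [folklore] -/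
theorem enorm_lconv_le (f g : (d → ℤ) → ℂ) (k : d → ℤ) :
    ‖lconv f g k‖ₑ ≤ ∑' m, ‖f m‖ₑ * ‖g (k - m)‖ₑ := by
  rw [lconv]
  refine enorm_tsum_le_tsum_enorm.trans (le_of_eq (tsum_congr fun m => ?_))
  rw [enorm_mul]

/-- **Young's inequality, transporting factor in `ℓ¹`**:
`∑_k ‖(f ⋆ g)(k)‖² ≤ (∑ₘ ‖f m‖)² ∑_k ‖g k‖²` (weighted Cauchy–Schwarz in `m`, exchange of the
sums, translation invariance of the counting measure). [folklore] -/
theorem hnorm_zero_lconv_le_left (f g : (d → ℤ) → ℂ) :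
    hnorm 0 (lconv f g) ≤ l1norm f ^ 2 * hnorm 0 g := by
  rw [hnorm_zero, hnorm_zero, l1norm]
  calc ∑' k, ‖lconv f g k‖ₑ ^ 2 ≤ ∑' k, (∑' m, ‖f m‖ₑ * ‖g (k - m)‖ₑ) ^ 2 := by
        gcongr with k
        exact enorm_lconv_le f g k
    _ ≤ ∑' k, ((∑' m, ‖f m‖ₑ) * ∑' m, ‖f m‖ₑ * ‖g (k - m)‖ₑ ^ 2) := by
        gcongr with k
        have h := sq_tsum_mul_le_tsum_mul_tsum (fun m => ‖g (k - m)‖ₑ) (fun m => ‖f m‖ₑ)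
        simpa only [mul_comm] using h
    _ = (∑' m, ‖f m‖ₑ) * ∑' m, (‖f m‖ₑ * ∑' k, ‖g (k - m)‖ₑ ^ 2) := by
        rw [ENNReal.tsum_mul_left, ENNReal.tsum_comm]
        congr 1
        exact tsum_congr fun m => ENNReal.tsum_mul_left
    _ = (∑' m, ‖f m‖ₑ) * ∑' m, (‖f m‖ₑ * ∑' k, ‖g k‖ₑ ^ 2) := by
        congr 1
        refine tsum_congr fun m => ?_
        congr 1
        exact (Equiv.subRight m).tsum_eq (fun k => ‖g k‖ₑ ^ 2)
    _ = (∑' m, ‖f m‖ₑ) ^ 2 * ∑' k, ‖g k‖ₑ ^ 2 := by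
        rw [ENNReal.tsum_mul_right, sq, mul_assoc]

/-- **Young's inequality, transported factor in `ℓ¹`**:
`∑_k ‖(f ⋆ g)(k)‖² ≤ ∑_k ‖f k‖² (∑ₘ ‖g m‖)²` (the previous one after `f ⋆ g = g ⋆ f`). [folklore] -/
theorem hnorm_zero_lconv_le_right (f g : (d → ℤ) → ℂ) :
    hnorm 0 (lconv f g) ≤ hnorm 0 f * l1norm g ^ 2 := by
  rw [show lconv f g = lconv g f from funext (lconv_comm f g), mul_comm]
  exact hnorm_zero_lconv_le_left g f

/-- Pairing bound in `ℓ²`: `(∑_k ‖a k‖ ‖b k‖)² ≤ (∑ ‖a‖²)(∑ ‖b‖²)`, i.e.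
`(∑ ‖a‖ ‖b‖)² ≤ hnorm 0 a · hnorm 0 b`. [folklore] -/
theorem sq_tsum_enorm_mul_enorm_le {E : Type*} [NormedAddCommGroup E] (a b : (d → ℤ) → E) :
    (∑' k, ‖a k‖ₑ * ‖b k‖ₑ) ^ 2 ≤ hnorm 0 a * hnorm 0 b := by
  rw [hnorm_zero, hnorm_zero]
  exact sq_tsum_mul_le _ _

end Young

/-! ### Interpolation in the integer scale -/

section Interpolation

variable {d : Type*} [Fintype d] {E : Type*} [NormedAddCommGroup E]

/-- One step of "pushing the orders apart": `‖c‖²_{h^{i+1}} ‖c‖²_{h^{j}} ≤ ‖c‖²_{h^i} ‖c‖²_{h^{j+1}}`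
for `i + 1 ≤ j` (log-convexity iterated; the slopes of `s ↦ log ‖c‖_{h^s}` increase). [folklore] -/
theorem hnorm_succ_mul_hnorm_le (c : (d → ℤ) → E) {i j : ℕ} (hij : i + 1 ≤ j) :
    hnorm (i + 1) c * hnorm j c ≤ hnorm i c * hnorm (j + 1) c := by
  obtain ⟨n, rfl⟩ := Nat.exists_eq_add_of_le hij
  induction n with
  | zero =>
    simpa [sq, add_assoc] using hnorm_succ_sq_le i c
  | succ n ih =>
    -- `X · h_j ≤ Y · h_j` with `j = i + 1 + n`, then cancel `h_j ∈ (0, ∞)`.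
    rw [show i + 1 + (n + 1) = i + 1 + n + 1 by omega]
    have hlc : hnorm (i + 1 + n + 1) c ^ 2 ≤ hnorm (i + 1 + n) c * hnorm (i + 1 + n + 2) c :=
      hnorm_succ_sq_le (i + 1 + n) c
    have ih' := ih (by omega)
    by_cases h0 : hnorm (i + 1 + n) c = 0
    · have hc : c = 0 := eq_zero_of_hnorm_eq_zero h0
      subst hc
      simp [hnorm_zero_fun']
    by_cases htop : hnorm (i + 1 + n) c = ∞
    · have h1 : hnorm (i + 1 + n + 1 + 1) c = ∞ :=
        eq_top_iff.2 (htop ▸ hnorm_mono (by omega) c)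
      by_cases hi : hnorm i c = 0
      · have hc : c = 0 := eq_zero_of_hnorm_eq_zero hi
        subst hc
        simp [hnorm_zero_fun']
      · rw [h1, ENNReal.mul_top hi]
        exact le_top
    have key : hnorm (i + 1) c * hnorm (i + 1 + n + 1) c * hnorm (i + 1 + n) c ≤
        hnorm i c * hnorm (i + 1 + n + 1 + 1) c * hnorm (i + 1 + n) c :=
      calc hnorm (i + 1) c * hnorm (i + 1 + n + 1) c * hnorm (i + 1 + n) c
          = (hnorm (i + 1) c * hnorm (i + 1 + n) c) * hnorm (i + 1 + n + 1) c := by ring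
        _ ≤ (hnorm i c * hnorm (i + 1 + n + 1) c) * hnorm (i + 1 + n + 1) c := by
            gcongr
        _ = hnorm i c * hnorm (i + 1 + n + 1) c ^ 2 := by ring
        _ ≤ hnorm i c * (hnorm (i + 1 + n) c * hnorm (i + 1 + n + 2) c) := by gcongr
        _ = hnorm i c * hnorm (i + 1 + n + 1 + 1) c * hnorm (i + 1 + n) c := by ring
    exact (ENNReal.mul_le_mul_iff_left h0 htop).1 key

/-- **Interpolation in the integer scale**: if `r ≤ s₁`, `r ≤ s₂` and `s₁ + s₂ ≤ r + m` (so that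
`s₁, s₂ ≤ m`) then `‖c‖²_{h^{s₁}} ‖c‖²_{h^{s₂}} ≤ ‖c‖²_{h^r} ‖c‖²_{h^m}`. This is how a product of
two intermediate norms is traded for (low norm) × (top norm) in the energy estimate; it is the
exact (constant `1`) lattice analogue, between integer orders, of the interpolation inequality
Majda–Bertozzi 2002 use as Lemma 3.8 (`‖v‖_{s'} ≤ C_s ‖v‖₀^{1-s'/s} ‖v‖_s^{s'/s}`). [folklore] -/
theorem hnorm_mul_hnorm_le (c : (d → ℤ) → E) {r s₁ s₂ m : ℕ} (h₁ : r ≤ s₁) (h₂ : r ≤ s₂)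
    (hsum : s₁ + s₂ ≤ r + m) :
    hnorm s₁ c * hnorm s₂ c ≤ hnorm r c * hnorm m c := by
  -- push `min s₁ s₂` down to `r` and the other order up by the same amount
  have push : ∀ t s : ℕ, r + t ≤ s → hnorm (r + t) c * hnorm s c ≤ hnorm r c * hnorm (s + t) c := by
    intro t
    induction t with
    | zero => intro s _; simp
    | succ t ih =>
      intro s hs
      calc hnorm (r + (t + 1)) c * hnorm s c = hnorm (r + t + 1) c * hnorm s c := by
            rw [add_assoc]
        _ ≤ hnorm (r + t) c * hnorm (s + 1) c := hnorm_succ_mul_hnorm_le c (by omega)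
        _ ≤ hnorm r c * hnorm (s + 1 + t) c := ih (s + 1) (by omega)
        _ = hnorm r c * hnorm (s + (t + 1)) c := by rw [add_assoc, add_comm 1 t]
  wlog hle : s₁ ≤ s₂ generalizing s₁ s₂
  · rw [mul_comm]
    exact this h₂ h₁ (by omega) (by omega)
  obtain ⟨t, rfl⟩ := Nat.exists_eq_add_of_le h₁
  calc hnorm (r + t) c * hnorm s₂ c ≤ hnorm r c * hnorm (s₂ + t) c := push t s₂ hle
    _ ≤ hnorm r c * hnorm m c := by
        gcongr
        exact hnorm_mono (by omega) c

end Interpolation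






end EulerFourier

end Literature.Analysis.FluidPDE
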